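import Summits.HodgeConjecture.HodgeConjecture.Theorems.K2E3BranchBShearFrameLetters     -- ★ p862422 (this seat, (W-3)): the shear constant `c` with a unit skew part, `valued_fixed_mul_add_fixed_mul_eq_max`, dyadic `ε₀ = 1`; brings ★ `valued_conjLocal_apply_of_smul_eq`, ★ `HeisRing.skewPart`
import HarnessLib

/-!
# K2 ∕ E3 «EllipticInputs», unit U4 «Keys» — socket :155 (depth 0, Branch B) at EVERY non-split place unramified in `L`: THE 2-FREE SHEAR CHART LETTERS
# `R = R⁺·c ⊕ R⁻` (`u = (u + σu)·c + (u − (u + σu)·c)`, fixed × skew, unique), the reading `|(s·c + y)_w| = max(|s_w|, |y_w|)`, and the `y`-fibres of the unit sphere over `s`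

Cell hodgecm-mathlib (D-0151), FLOOR 0, Track B «K2-LIT», engine E3, crux item H413 = stmt-HodgeConjecture-24833 (route `HCCMUnconditional`, no route verbs); target BY NAME the
OPEN socket `…U4Keys.sig_K2E3KeysThmTwoContractingRamifiedCharOneDepthZeroNormTrivial` (:155).  ★ (W-2)∕(W-4) (this seat) reduced :155 at an inert place to the shell values; at `v ∤ 2`
the cell's Z3-c chain pays them in the chart `R = R⁺ ⊕ R⁻`, `z = a + y` (★ `HeisRing.ringDecomp`, readings ★ `valued_add_apply_eq_max` under `|2|_w = 1`).  For the UNOWNED dyadic-inert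
twin the chart is `R = R⁺·c ⊕ R⁻` for the shear constant `c` of ★ (W-3) (`σc + c = 1`, `|c_w| ≤ 1`): every `u ∈ R` is `u = s·c + y` with `s = u + σu` σ-FIXED and `y = u − (u + σu)·c` SKEW,
uniquely, and `|(s·c + y)_w| = max(|s_w|, |y_w|)` — 2-FREE.  These are the def-free letters the dyadic (II)-b2 «Φ₁» ∕ (II)-b3 assembler needs (the 2-free twins of ★ (II)-b3a's
`valued_add_apply_eq_max` and of the fibre dictionary of ★ `K2E3BranchBSkewLineIntegrals` §2): Fubini over `R⁺ × R⁻` through `(s, y) ↦ s·c + y` (`= ringDecomp⁻¹(s∕2, (s∕2)·δ₀ + y)`, a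
shear of the ★ chart, so `μR = κ • ((μ⁺ ⊗ μ⁻) ∘ chart⁻¹)` by Mathlib `MeasurePreserving.skew_product`), fibre over `|s_w| = 1` = the skew unit ball (`Φ₁^c = ∫_{|y| ≤ 1} E(c + y)`, `χ₁(s) = 1`
and `y ↦ y∕s`), over `|s_w| < 1` = the skew unit sphere (`ε₀·μ⁻{|y|_w = 1}` by depth zero), over `|s_w| > 1` = `∅`; orthogonality ★ `integral_indicator_sphere_dite_eq_zero` (parity-free)
then gives `Φ₁^c = −ε₀·μ⁻(𝔪⁻)` at every unramified non-split place, `ε₀ = 1` at the dyadic ones (★ (W-3) §3).  Typed by the S1 hand R90-C10-p04 (g0) (K2 chair valve 2026-09-04T21:53Z,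
dealer K2E3-plan (g5) ROUND 3 (4)).  `--supports stmt-HodgeConjecture-24833 --as helper`; THEOREMS ONLY (no `def`, no `instance`, no notation, no named-fact hypothesis, no `sorry`).  NOT THE PAYER.

* §1 **the chart**: `conjLocal_add_conjLocal` (`u + σu` is fixed), `conjLocal_sub_add_conjLocal_mul` (`u − (u + σu)·c` is skew), `add_conjLocal_mul_add_sub` (they recompose `u`),
  `fixed_eq_add_conjLocal` ∕ `skew_eq_sub_add_conjLocal_mul` (uniqueness of the decomposition `u = s·c + y`).
* §2 **the reading**: `valued_fixed_mul_add_skew_eq_max` — `|(s·c + y)_w| = max(|s_w|, |y_w|)` (`s` fixed, `y` skew); `valued_fixed_mul_add_skew_le_one_iff`.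
* §3 **the `y`-fibres of the unit sphere `{|u|_w = 1}` over `s`** (as subsets of `↥(skewPart σ)`): `skewFibre_eq_ball_of_valued_eq_one` (`|s_w| = 1`: the unit ball), `skewFibre_eq_sphere_of_valued_lt_one`
  (`|s_w| < 1`: the unit sphere), `skewFibre_eq_empty_of_one_lt_valued` (`|s_w| > 1`: empty).

HONEST LABEL: HC_CM is proved only modulo the 7 printed citations (2 remaining named inputs: hLiu418 = stmt-HodgeConjecture-24832, h413 = stmt-HodgeConjecture-24833)
until rung 0 closes; count-neutral — this file does NOT pay the socket; no printed citation is discharged.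

## References
* [Rogawski1990] J. Rogawski, *Automorphic representations of unitary groups in three variables*, Ann. of Math. Stud. 123 (1990), §1.10 p. 9, §12.2 (2) p. 173.
* [Serre1979] J.-P. Serre, *Local Fields*, GTM 67 (1979), Ch. V §2.
* [WeilBNT1967] A. Weil, *Basic Number Theory* (1967), Ch. II §5 (Haar measure and Fubini on local fields).
* [Keys1984] D. Keys, *Principal series representations of special unitary groups over local fields*, Compositio Math. 51 (1984), §4, §7 Thm. (2) p. 126.
-/

set_option autoImplicit false
-- the mandated namespace has the single-problem summit's repeated segment (`HodgeConjecture.HodgeConjecture`)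
set_option linter.dupNamespace false

noncomputable section

open NumberField IsDedekindDomain
open Literature.NumberTheory Literature.NumberTheory.Automorphic Literature.NumberTheory.Automorphic.UnitaryGroup

namespace Summit.HodgeConjecture.HodgeConjecture.Cruxes.H413.K2E3BranchBShearChartLetters

open Summit.HodgeConjecture.HodgeConjecture.Cruxes.H413
open Summit.HodgeConjecture.HodgeConjecture.Cruxes.H413.K2E3BranchBShearFrameLetters

variable (L : Type) [Field L] [NumberField L] [IsCMField L] (v : HeightOneSpectrum (𝓞 ↥(maximalRealSubfield L)))
  (w : PlacesOver L v) (hw : IsCMField.complexConj L • w.1 = w.1)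

/-! ## §1 The chart `R = R⁺·c ⊕ R⁻`: `u = (u + σu)·c + (u − (u + σu)·c)` -/

/-- `u + σu` is `σ`-fixed (`σ` is an involution, ★ `conjLocal_conjLocal_cm`). [cite: Rogawski1990, §1.10 p. 9] -/
theorem conjLocal_add_conjLocal (u : LocalRing L v) :
    conjLocal L (IsCMField.complexConj L) v (u + conjLocal L (IsCMField.complexConj L) v u) = u + conjLocal L (IsCMField.complexConj L) v u := by
  rw [map_add, conjLocal_conjLocal_cm L v u, add_comm]

/-- `u − (u + σu)·c` is skew when `σc + c = 1`. [cite: Rogawski1990, §1.10 p. 9] -/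
theorem conjLocal_sub_add_conjLocal_mul {c : LocalRing L v} (hc : conjLocal L (IsCMField.complexConj L) v c + c = 1) (u : LocalRing L v) :
    conjLocal L (IsCMField.complexConj L) v (u - (u + conjLocal L (IsCMField.complexConj L) v u) * c) =
      -(u - (u + conjLocal L (IsCMField.complexConj L) v u) * c) := by
  rw [map_sub, map_mul, conjLocal_add_conjLocal L v u, eq_sub_of_add_eq hc]; ring

/-- `u − (u + σu)·c ∈ R⁻` when `σc + c = 1`. [cite: Rogawski1990, §1.10 p. 9] -/
theorem sub_add_conjLocal_mul_mem_skewPart {c : LocalRing L v} (hc : conjLocal L (IsCMField.complexConj L) v c + c = 1) (u : LocalRing L v) :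
    u - (u + conjLocal L (IsCMField.complexConj L) v u) * c ∈ HeisRing.skewPart (conjLocal L (IsCMField.complexConj L) v) :=
  (HeisRing.mem_skewPart_iff _ _).2 (conjLocal_sub_add_conjLocal_mul L v hc u)

/-- The two coordinates recompose `u`: `(u + σu)·c + (u − (u + σu)·c) = u`. [cite: Rogawski1990, §1.10 p. 9] -/
theorem add_conjLocal_mul_add_sub (c u : LocalRing L v) :
    (u + conjLocal L (IsCMField.complexConj L) v u) * c + (u - (u + conjLocal L (IsCMField.complexConj L) v u) * c) = u :=
  add_sub_cancel _ _

/-- UNIQUENESS, fixed coordinate: if `u = s·c + y` with `s` fixed and `y` skew then `s = u + σu`. [cite: Rogawski1990, §1.10 p. 9] -/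
theorem fixed_eq_add_conjLocal {c s y : LocalRing L v} (hc : conjLocal L (IsCMField.complexConj L) v c + c = 1)
    (hs : conjLocal L (IsCMField.complexConj L) v s = s) (hy : conjLocal L (IsCMField.complexConj L) v y = -y) :
    s = (s * c + y) + conjLocal L (IsCMField.complexConj L) v (s * c + y) := by
  rw [map_add, map_mul, hs, hy, eq_sub_of_add_eq hc]; ring

/-- UNIQUENESS, skew coordinate: if `u = s·c + y` with `s` fixed and `y` skew then `y = u − (u + σu)·c`. [cite: Rogawski1990, §1.10 p. 9] -/
theorem skew_eq_sub_add_conjLocal_mul {c s y : LocalRing L v} (hc : conjLocal L (IsCMField.complexConj L) v c + c = 1)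
    (hs : conjLocal L (IsCMField.complexConj L) v s = s) (hy : conjLocal L (IsCMField.complexConj L) v y = -y) :
    y = (s * c + y) - ((s * c + y) + conjLocal L (IsCMField.complexConj L) v (s * c + y)) * c := by
  rw [← fixed_eq_add_conjLocal L v hc hs hy]; ring

/-! ## §2 The reading `|(s·c + y)_w| = max(|s_w|, |y_w|)` (2-free) -/

include hw in
/-- **`|(s·c + y)_w| = max(|s_w|, |y_w|)`** for `σc + c = 1`, `|c_w| ≤ 1`, `s` σ-fixed, `y` skew — 2-FREE (`u + σu = s` and `y = u − s·c`; `σ` is an isometry at the non-split `w`).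
The 2-free twin of ★ (II)-b3a `valued_add_apply_eq_max` (`|a + y|_w = max(|a|_w, |y|_w)`, which needs `|2|_w = 1`). [cite: Rogawski1990, §1.10 p. 9] [cite: Serre1979, Ch. V §2] -/
theorem valued_fixed_mul_add_skew_eq_max {c s y : LocalRing L v} (hc : conjLocal L (IsCMField.complexConj L) v c + c = 1) (hcv : Valued.v (c w) ≤ 1)
    (hs : conjLocal L (IsCMField.complexConj L) v s = s) (hy : conjLocal L (IsCMField.complexConj L) v y = -y) :
    Valued.v ((s * c + y) w) = max (Valued.v (s w)) (Valued.v (y w)) := by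
  apply le_antisymm
  · rw [Pi.add_apply]
    refine (Valuation.map_add _ _ _).trans (max_le_max ?_ le_rfl)
    rw [Pi.mul_apply, map_mul]
    calc Valued.v (s w) * Valued.v (c w) ≤ Valued.v (s w) * 1 := mul_le_mul' le_rfl hcv
      _ = Valued.v (s w) := mul_one _
  · have hsle : Valued.v (s w) ≤ Valued.v ((s * c + y) w) := by
      conv_lhs => rw [fixed_eq_add_conjLocal L v hc hs hy]
      rw [Pi.add_apply]
      refine (Valuation.map_add _ _ _).trans (max_le le_rfl ?_)
      rw [valued_conjLocal_apply_of_smul_eq L v w hw]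
    have hyle : Valued.v (y w) ≤ Valued.v ((s * c + y) w) := by
      have h1 : Valued.v (y w) = Valued.v (((s * c + y) - s * c) w) := by rw [add_sub_cancel_left]
      rw [h1, Pi.sub_apply]
      refine (Valuation.map_sub _ _ _).trans (max_le le_rfl ?_)
      rw [Pi.mul_apply, map_mul]
      calc Valued.v (s w) * Valued.v (c w) ≤ Valued.v ((s * c + y) w) * 1 := mul_le_mul' hsle hcv
        _ = Valued.v ((s * c + y) w) := mul_one _
    exact max_le hsle hyle

include hw in
/-- `|(s·c + y)_w| ≤ 1 ⟺ |s_w| ≤ 1 ∧ |y_w| ≤ 1` (`s` fixed, `y` skew). [cite: Rogawski1990, §1.10 p. 9] -/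
theorem valued_fixed_mul_add_skew_le_one_iff {c s y : LocalRing L v} (hc : conjLocal L (IsCMField.complexConj L) v c + c = 1) (hcv : Valued.v (c w) ≤ 1)
    (hs : conjLocal L (IsCMField.complexConj L) v s = s) (hy : conjLocal L (IsCMField.complexConj L) v y = -y) :
    Valued.v ((s * c + y) w) ≤ 1 ↔ Valued.v (s w) ≤ 1 ∧ Valued.v (y w) ≤ 1 := by
  rw [valued_fixed_mul_add_skew_eq_max L v w hw hc hcv hs hy, max_le_iff]

/-! ## §3 The `y`-fibres of the unit sphere `{|u|_w = 1}` over the fixed coordinate `s` -/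

include hw in
/-- Over `|s_w| = 1` the fibre `{y ∈ R⁻ : |(s·c + y)_w| = 1}` is the skew unit BALL `{|y_w| ≤ 1}`. [cite: Rogawski1990, §1.10 p. 9] [cite: Keys1984, §4] -/
theorem skewFibre_eq_ball_of_valued_eq_one {c s : LocalRing L v} (hc : conjLocal L (IsCMField.complexConj L) v c + c = 1) (hcv : Valued.v (c w) ≤ 1)
    (hs : conjLocal L (IsCMField.complexConj L) v s = s) (hs1 : Valued.v (s w) = 1) :
    {y : ↥(HeisRing.skewPart (conjLocal L (IsCMField.complexConj L) v)) | Valued.v ((s * c + (y : LocalRing L v)) w) = 1} =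
      {y : ↥(HeisRing.skewPart (conjLocal L (IsCMField.complexConj L) v)) | Valued.v ((y : LocalRing L v) w) ≤ 1} := by
  ext y
  rw [Set.mem_setOf_eq, Set.mem_setOf_eq, valued_fixed_mul_add_skew_eq_max L v w hw hc hcv hs ((HeisRing.mem_skewPart_iff _ _).1 y.2), hs1]
  constructor
  · intro h; rw [← h]; exact le_max_right _ _
  · intro h; exact max_eq_left h

include hw in
/-- Over `|s_w| < 1` the fibre `{y ∈ R⁻ : |(s·c + y)_w| = 1}` is the skew unit SPHERE `{|y_w| = 1}`. [cite: Rogawski1990, §1.10 p. 9] [cite: Keys1984, §4] -/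
theorem skewFibre_eq_sphere_of_valued_lt_one {c s : LocalRing L v} (hc : conjLocal L (IsCMField.complexConj L) v c + c = 1) (hcv : Valued.v (c w) ≤ 1)
    (hs : conjLocal L (IsCMField.complexConj L) v s = s) (hs1 : Valued.v (s w) < 1) :
    {y : ↥(HeisRing.skewPart (conjLocal L (IsCMField.complexConj L) v)) | Valued.v ((s * c + (y : LocalRing L v)) w) = 1} =
      {y : ↥(HeisRing.skewPart (conjLocal L (IsCMField.complexConj L) v)) | Valued.v ((y : LocalRing L v) w) = 1} := by
  ext y
  rw [Set.mem_setOf_eq, Set.mem_setOf_eq, valued_fixed_mul_add_skew_eq_max L v w hw hc hcv hs ((HeisRing.mem_skewPart_iff _ _).1 y.2)]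
  constructor
  · intro h
    rcases max_eq_iff.1 h with ⟨h1, -⟩ | ⟨h1, -⟩
    · exact absurd h1 (ne_of_lt hs1)
    · exact h1
  · intro h; rw [h]; exact max_eq_right (le_of_lt hs1)

include hw in
/-- Over `1 < |s_w|` the fibre `{y ∈ R⁻ : |(s·c + y)_w| = 1}` is EMPTY. [cite: Rogawski1990, §1.10 p. 9] [cite: Keys1984, §4] -/
theorem skewFibre_eq_empty_of_one_lt_valued {c s : LocalRing L v} (hc : conjLocal L (IsCMField.complexConj L) v c + c = 1) (hcv : Valued.v (c w) ≤ 1)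
    (hs : conjLocal L (IsCMField.complexConj L) v s = s) (hs1 : 1 < Valued.v (s w)) :
    {y : ↥(HeisRing.skewPart (conjLocal L (IsCMField.complexConj L) v)) | Valued.v ((s * c + (y : LocalRing L v)) w) = 1} = ∅ := by
  ext y
  rw [Set.mem_setOf_eq, Set.mem_empty_iff_false, iff_false, valued_fixed_mul_add_skew_eq_max L v w hw hc hcv hs ((HeisRing.mem_skewPart_iff _ _).1 y.2)]
  intro h
  have h1 : Valued.v (s w) ≤ 1 := by rw [← h]; exact le_max_left _ _
  exact absurd h1 (not_le.2 hs1)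

include hw in
/-- The unit BALL `{|u|_w ≤ 1}` in the chart: over `|s_w| ≤ 1` its `y`-fibre is the skew unit ball, over `|s_w| > 1` it is empty — i.e. `N₀ ↔ 𝒪⁺ × 𝒪⁻`. [cite: Rogawski1990, §1.10 p. 9] -/
theorem skewBallFibre_eq_of_valued_le_one {c s : LocalRing L v} (hc : conjLocal L (IsCMField.complexConj L) v c + c = 1) (hcv : Valued.v (c w) ≤ 1)
    (hs : conjLocal L (IsCMField.complexConj L) v s = s) (hs1 : Valued.v (s w) ≤ 1) :
    {y : ↥(HeisRing.skewPart (conjLocal L (IsCMField.complexConj L) v)) | Valued.v ((s * c + (y : LocalRing L v)) w) ≤ 1} =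
      {y : ↥(HeisRing.skewPart (conjLocal L (IsCMField.complexConj L) v)) | Valued.v ((y : LocalRing L v) w) ≤ 1} := by
  ext y
  rw [Set.mem_setOf_eq, Set.mem_setOf_eq, valued_fixed_mul_add_skew_le_one_iff L v w hw hc hcv hs ((HeisRing.mem_skewPart_iff _ _).1 y.2)]
  exact ⟨fun h => h.2, fun h => ⟨hs1, h⟩⟩

end Summit.HodgeConjecture.HodgeConjecture.Cruxes.H413.K2E3BranchBShearChartLetters

end
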